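import Mathlib
import Summits.Ventures.LatticeQCDFlow.Scaling.U1LeadingCoefficient
import Summits.Ventures.LatticeQCDFlow.Scaling.CrossCutFloorOfLeadingCoeff

/-!
# LatticeQCDFlow / Scaling — (U′) AT STRONG COUPLING FOR `U(1)`, `R = 0`: the cross-cut
# plaquette–plaquette correlator floor holds uniformly in the volume for every small `β ≠ 0`

HONEST FRAMING: exact (Metropolis-corrected) sampling algorithms for lattice gauge theory;
figures of merit are autocorrelation/cost numbers at stated couplings and volumes; no
continuum-physics claim.

Venture `LatticeQCDFlow` (cell pub-lqcd), topic `Scaling`, FANOUT row 30 (lean-1) — OUR WORK, the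
assembly (LEAD LINE 205 (2) / 225 RL-47 (107); THEORY-1 §40.3 "(O3)-size"; T2-AK / T2-AL):
* `torusTruncC_leadingCoeff_u1_one` — hypothesis (LC) of theory2's items 120 / 121 at separation
  `t = 1` for `G = U(1) = Circle`, `ρ = u1Rep`: for every torus side `L + 1 ≥ 3`, every `d`,
  `i < j`, `a ∉ {i, j}`,
  `torusTruncC u1Rep (L+1) P P e_a β − β⁴/32 = O(β⁵)` at `β = 0` (`P = plaquetteObs u1Rep 0 i j`;
  `Scaling/U1LeadingCoefficient.truncated_expect_jetEq_u1` read through item 120's `torusTruncC`);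
* **`crossCutCorrelatorFloor_u1`**, **`crossCutCorrelatorFloorR_u1`** — there is ONE `β₀ > 0`
  such that `Conjectures.CrossCutCorrelatorFloor d 1 Circle u1Rep β 0 i j a` (and the repaired
  item `…FloorR`) holds for EVERY real `β ≠ 0` with `|β| ≤ β₀`: the connected correlator of two
  parallel `U(1)` plaquettes one lattice unit apart is at least `|β|⁴/64` on every torus of side
  `≥ 3`, at every site — hypothesis (U′) of the volume law (`Barriers.VolumeScalingOfTraining`,
  `Theory2.BlockDefectVolumeLaw`) with NO physics input, at strong coupling, `R = 0`, `U(1)`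
  (item 121's bridge `crossCutCorrelatorFloor_of_leadingCoeff` + item 120's analytic floor).
The printed leading tube [cite: MontvayMunster1994, §3.6.2 (3.437)]; [cite: Schor1984, Thm 3.2].
What is NOT claimed: general `R` (the `4(2R+1)`-tube census), `SU(N)`, intermediate `β`.
Elementary given the imports; nothing is cited as a fact; no `def`, no `sorry`.
-/

noncomputable section

open MeasureTheory Filter Topology Asymptotics
open Literature.MathematicalPhysics.QuantumFieldTheory
open Literature.MathematicalPhysics.QuantumLattice (u1Rep continuous_u1Rep plaquetteObs)
open Summit.Ventures.LatticeQCDFlow.Theory2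

namespace Summit.Ventures.LatticeQCDFlow.Theory2.Lattice.U1Torus

variable {d : ℕ} {i j a : Fin d}

/-- **(LC) at `t = 1` for `U(1)` in item 120's vocabulary**: for every torus side `L + 1 ≥ 3`,
`torusTruncC u1Rep (L+1) P P e_a β − β⁴/32 = O(β⁵)` at `β = 0`. [folklore] -/
theorem torusTruncC_leadingCoeff_u1_one (hij : i < j) (hai : a ≠ i) (haj : a ≠ j) (L : ℕ)
    (hL : 2 ≤ L) :
    (fun β : ℂ => torusTruncC u1Rep (L + 1) (plaquetteObs u1Rep 0 i j) (plaquetteObs u1Rep 0 i j)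
        (Pi.single a 1) β - (((32 : ℝ)⁻¹ : ℝ) : ℂ) * β ^ 4) =O[𝓝 (0 : ℂ)] fun β => β ^ (4 + 1) := by
  have h := truncated_expect_jetEq_u1 (d := d) (L := L + 1) (by omega) hij hai haj
  have e : ∀ β : ℂ, (((32 : ℝ)⁻¹ : ℝ) : ℂ) * β ^ 4 = β ^ 4 / 32 := by
    intro β; push_cast; ring
  simp only [e]
  exact h

/-- **(U′) AT STRONG COUPLING, `U(1)`, `R = 0`.**  For `d`-dimensional compact `U(1)` lattice gauge
theory (`d ≥ 3` through `i < j`, `a ∉ {i, j}`): there is `β₀ > 0` such that for every real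
`β ≠ 0` with `|β| ≤ β₀` the venture's cross-cut correlator floor
`Conjectures.CrossCutCorrelatorFloor d 1 Circle u1Rep β 0 i j a` holds (`δ = |β|⁴/64`, all torus
sides `≥ 3`, all sites). [folklore] -/
theorem crossCutCorrelatorFloor_u1 (hij : i < j) (hai : a ≠ i) (haj : a ≠ j) :
    ∃ β₀ : ℝ, 0 < β₀ ∧ ∀ β : ℝ, β ≠ 0 → |β| ≤ β₀ →
      Conjectures.CrossCutCorrelatorFloor d 1 Circle u1Rep β 0 i j a := by
  refine crossCutCorrelatorFloor_of_leadingCoeff u1Rep continuous_u1Rep i j a 0 (n := 4)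
    (b := (32 : ℝ)⁻¹) (by norm_num) 2 fun L hL => ?_
  have hv : (Pi.single a ((2 * 0 + 1 : ℕ) : ℤ) : Literature.Probability.LatticeModels.Site d) =
      Pi.single a 1 := by norm_num
  rw [hv]
  exact torusTruncC_leadingCoeff_u1_one hij hai haj L hL

/-- **The repaired item (U′-R) at strong coupling, `U(1)`, `R = 0`.** [folklore] -/
theorem crossCutCorrelatorFloorR_u1 (hij : i < j) (hai : a ≠ i) (haj : a ≠ j) :
    ∃ β₀ : ℝ, 0 < β₀ ∧ ∀ β : ℝ, β ≠ 0 → |β| ≤ β₀ →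
      Conjectures.CrossCutCorrelatorFloorR d 1 Circle u1Rep β 0 i j a := by
  refine crossCutCorrelatorFloorR_of_leadingCoeff u1Rep continuous_u1Rep i j a 0 (n := 4)
    (b := (32 : ℝ)⁻¹) (by norm_num) 2 fun L hL => ?_
  have hv : (Pi.single a ((2 * 0 + 1 : ℕ) : ℤ) : Literature.Probability.LatticeModels.Site d) =
      Pi.single a 1 := by norm_num
  rw [hv]
  exact torusTruncC_leadingCoeff_u1_one hij hai haj L hL

end Summit.Ventures.LatticeQCDFlow.Theory2.Lattice.U1Torus

end
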